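import Summits.QuantumFields.YangMills.Theorems.BalabanUVNodesN11PerBondChartsOfInjectivityWindowsAC
import Summits.QuantumFields.YangMills.Theorems.BalabanUVNodesN11InnerTransportInPrivateCoordinateChart
import Summits.QuantumFields.YangMills.Theorems.BalabanUVNodesN09CentralWindowAtRecord
import Literature.MathematicalPhysics.QuantumFieldTheory.Balaban1983to89.BlockAveragingPlaquetteBoundLocal

/-!
# DAG node N11 — (B4)'s CHART HALF AT `fieldMeasure` WITH NO DISPLAYED PER-BOND HYPOTHESIS: the private-coordinate chart of the averaging of record ON THE CENTRAL α-WINDOW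
# (dag-n09-w6's injectivity window) — Lusin–Souslin inverse + kernel Radon–Nikodym law —, modulo the SUPPORT CLAUSE only; and the support clause in PLAQUETTE currency

HEADER — WORK-UNIT METADATA.  Cell `pub-ymgap`, YM-PLAN Track A (HUMAN RULING D-0062 ∕ D-0149 ∕ D-0154 (3a)), WIDTH SEAT `pub-ymgap-dag-n11-w6` (g2) on node N11 [B14];
route `BalabanUVNodes`, key item K1⁷ `StabilityBAtRecordR13SepCoPH` = stmt-QuantumFields-20542 (helper lane, `--kind proof --supports 20542 --as helper`, count-neutral; MIS-KEY∕VALID under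
KEY MAP v2 — K1⁹ is stmt-QuantumFields-27364).  [I] = [Balaban1987RG1], [III] = [Balaban1988Convergent].  Bus: CLAIM-5 = INTENT-5 of this seat (R455 (A)).  Over this seat's files 4 ∕ 3c
`…N11PerBondChartsOfInjectivityWindowsAC` ∕ `…N11InnerTransportInPrivateCoordinateChart` (per-bond bundle from injectivity windows ALONE; chart ∕ transport at `fieldMeasure` from BLIND injectivity windows), dag-n09-w6 g3's
`…N09CentralWindowAtRecord` (the CENTRAL α-WINDOW `Ωα_c(U) = {g | ∀ i, dist1 (fibreFamily U c (pre·g·post) i) ≤ α}`: jointly measurable, BLIND to the private coordinates, an INJECTIVITY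
window of `g ↦ Ū′(c)` for `0 ≤ α ≤ 1∕24`, `α < δ_N`, `offCard c ∕ |Idx| + 150α < 1`, and `U(β c) ∈ Ωα_c(U) ↔ ∀ i, dist1 (loopHol U c i) ≤ α`) and pub-balaban's
`BlockAveragingPlaquetteBoundLocal.dist1_loopHol_le_local` (loop variables at `c` ≤ `((d+2)L)²∕4 ·` the plaquette deviation on the three blocks `B(c₋ − e_μ)`, `B(c₋)`, `B(c₊)`).

WHY THIS FILE.  After files 1–4 the private-coordinate edition of (B4)'s chart half at `fieldMeasure` displayed exactly: blind jointly-measurable injectivity windows + the support clause.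
dag-n09-w6's central α-window IS such a window (their INTENT-6∕7∕8∕9).  THIS FILE instantiates: for every small `α` there ARE `(T, ϑ, jd)` — coarse windows, inverses, densities, all jointly
measurable, NO law and NO Jacobian displayed — such that dag-n11-d's `hpush` ∕ `hfib` hold at `(fieldMeasure (k+1), Kernel.const _ (fieldMeasure k))` on the charted set
`S_α = {U | ∀ c i, dist1 (loopHol U c i) ≤ α}` («every (0.4) loop variable α-small») and def-T's `transportOfRecord F N K k ρ` IS `dV`-a.e. the resampled `dU`-integral for every
`dU`-integrable measurable `ρ` supported in `S_α`.  §2 restates the support clause in PLAQUETTE currency — what the small-field characteristic functions (2.17) ∕ (3.3) control —: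
`ρ(U) ≠ 0 ⇒` every fine plaquette based in the three blocks around each coarse bond is within `δ` of `1`, with `((d+2)L)²∕4 · δ ≤ α`.

WHAT THIS FILE PROVES (0 `def`, 0 `sorry`, standard axioms; `k < K`, `0 ≤ α ≤ 1∕24`, `α < δ_N`, `∀ c, offCard c ∕ |Idx| + 150α < 1`).
§1 ★★★ `exists_perBondCharts_centralWindow_ac` (dag-n09-w6's `exists_perBondCharts_of_forwardLaws` WITHOUT its four law hypotheses `jac ∕ hjacm ∕ hjac0 ∕ hfwd`: the same twelve conjuncts) ·
★★★ `exists_chart_transportOfRecord_ae_eq_centralWindow` (the chart ∕ `hpush` ∕ `hfib` ∕ transport identity on `S_α`, support clause «all loops α-small»).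
§2 `loops_small_of_plaqSmallOn_blocks` · ★ `exists_chart_transportOfRecord_ae_eq_of_plaqSmallSupport` (support clause in plaquette currency: `dist1 (U(∂q)) < δ` on the three blocks of every
coarse bond wherever `ρ ≠ 0`, `((d+2)L)²∕4 · δ ≤ α`).
§3 ★★★ `exists_innerChart_transportOfRecord_ae_eq_centralWindow` (file 3c's separated transport — outside un-charted, inside resampled — on the central windows: EVERY density with the support
clause at the coarse bonds OFF `sV′` only; the `hin₀` feeder of dag-n11-d's (O3′) chain with nothing displayed but the support clause).

HONEST FRAMING.  Helper lane of K1⁷; count-neutral; composition BY NAME (file 4 + dag-n09-w6's window + pub-balaban's local Stokes bound); the SUPPORT CLAUSE (loop ∕ plaquette smallness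
wherever the density is non-zero) remains the HYPOTHESIS — at the record it is what def-R's `χ_k(init s′)` ∕ the (3.3) factors are meant to give, NOT derived here; the Jacobian is a
Radon–Nikodym VERSION (no continuity); NO chart of Bałaban's ((47), [III] (3.10)–(3.25)) asserted — a valid chart of the disintegration, not print's; (B4) ∕ (S-α) NOT closed; N11 NOT
discharged; K1⁷ ∕ K1⁸ ∕ K1⁹ NOT closed, no registered stub touched; counts unmoved (typed 28∕28 · discharged 5∕27 · A 5∕28).  No summit statement is proved by this seat.  One finite
`𝕋⁴_{L^K}` programme at fixed `ε = L^{−K}`; R4 closes only the conditional finite-𝕋⁴ rung `BalabanLadder.UV` — NOT ℝ⁴, NOT OS, NOT a mass gap, NOT Clay.  No `sorry`, `axiom`, `def`, `instance`,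
`notation`.  Instance bookkeeping: NO local `DecidableEq (PBond …)` binders here — dag-n09-w6's window lemmas are elaborated at the tree's global `instDecidableEqPBond`, so this file
(and the `Fintype {c // c ∉ sV′}` ∕ `update` instances it passes down to files 3b∕3c∕4) uses the global instance throughout (cf. `B15Prop1IntrinsicAtCoPRecord` header).
Sources (SHAPE ∕ bookkeeping only): [I] (0.4) p.253, (2.9)–(2.10) pp.266–267; [III] (2.17) p.257, (3.1) p.264, (3.3) p.265, p.267 L18–24.
-/

noncomputable section

open MeasureTheory ProbabilityTheory Set Function
open scoped ENNReal NNReal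

namespace Summit.QuantumFields.YangMills.Theorems.BalabanUVNodesN11PrivateChartOfCentralWindow

open Literature.MathematicalPhysics.QuantumFieldTheory.Balaban1983to89
open Literature.MathematicalPhysics.QuantumFieldTheory.Balaban1983to89.T4AveragingDisintegration
open Literature.MathematicalPhysics.QuantumFieldTheory.Balaban1983to89.BlockAveraging (Small Idx avgFun loopHol)
open Literature.MathematicalPhysics.QuantumFieldTheory.Balaban1983to89.BlockAveragingHaarAC (centralBond pre post centralBond_injective isLocal_avgFun)
open Literature.MathematicalPhysics.QuantumFieldTheory.Balaban1983to89.BlockAveragingEMLHaarAC (fibreFamily offCard)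
open Literature.MathematicalPhysics.QuantumFieldTheory.Balaban1983to89.ExpMeanLog (expMeanLogSU deltaSU)
open Literature.MathematicalPhysics.QuantumFieldTheory.Balaban1983to89.BlockAveragingPlaquetteBoundLocal (dist1_loopHol_le_local)
open Summit.QuantumFields.YangMills.Theorems.BalabanUVNodesN11TransportOfRecordInPrivateCoordinateChart (succ_le_m_add_K)
open Summit.QuantumFields.YangMills.Theorems.BalabanUVNodesN11PerBondChartsOfInjectivityWindowsAC
open Summit.QuantumFields.YangMills.Theorems.BalabanUVNodesN11InnerPrivateCoordinateChartSocket (hpush_innerPrivateChart hfib_innerPrivateChart)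
open Summit.QuantumFields.YangMills.Theorems.BalabanUVNodesN11InnerTransportInPrivateCoordinateChart (transportOfRecord_comp_glue_ae_eq_kernelRTOfRecord_privateInnerChart)
open Summit.QuantumFields.YangMills.BalabanUVNodes.N09CentralWindowAtRecord
  (measurableSet_centralWindow centralWindow_extend avgFun_update_centralBond_injOn_centralWindow self_mem_centralWindow_iff)
open Node00 hiding SU
open T4Continuum

variable {F : T4Family} {N : ℕ} [NeZero N] {K k : ℕ}

/-! ## §1  The per-bond bundle and the chart of record on the central α-window, no law displayed -/

/-- **★★★ PER-BOND CHARTS OF THE CENTRAL α-WINDOW WITH NO DISPLAYED LAW** (dag-n09-w6's `exists_perBondCharts_of_forwardLaws` minus `jac ∕ hjacm ∕ hjac0 ∕ hfwd`): at step `k < K`, for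
`0 ≤ α ≤ 1∕24`, `α < δ_N` and `offCard c ∕ |Idx| + 150α < 1` at every coarse bond, the windows `Ωα_c(U) = {g | ∀ i, dist1 (fibreFamily U c (pre·g·post) i) ≤ α}` are jointly measurable, BLIND and
INJECTIVITY windows (their file), so file 4 gives `(T, ϑ, jd)` — jointly measurable image windows, two-sided inverses valued in the windows, Radon–Nikodym densities — with the inverse
change-of-variables laws. [cite: Balaban1987RG1, (0.4) p.253, (2.9) p.266 and (2.10) p.267; Kechris1995, Thm 15.1] -/
theorem exists_perBondCharts_centralWindow_ac (hk : k < K) {α : ℝ} (hα0 : 0 ≤ α) (hα : α ≤ 1 / 24)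
    (hαδ : α < deltaSU (Fin N)) (hgap : ∀ c : PBond (F.P K) (k + 1), (offCard c : ℝ) / (Fintype.card (Idx (F.P K)) : ℝ) + 150 * α < 1) :
    ∃ (T : PBond (F.P K) (k + 1) → GaugeField (F.P K) k (SU N) → Set (SU N))
      (ϑ : PBond (F.P K) (k + 1) → GaugeField (F.P K) k (SU N) → SU N → SU N)
      (jd : PBond (F.P K) (k + 1) → GaugeField (F.P K) k (SU N) → SU N → ℝ≥0),
      (∀ c, MeasurableSet {p : GaugeField (F.P K) k (SU N) × SU N | p.2 ∈
          {g : SU N | ∀ i : Idx (F.P K), dist1 (fibreFamily p.1 c (pre p.1 c * g * post p.1 c) i) ≤ α}}) ∧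
      (∀ c (U : GaugeField (F.P K) k (SU N)) (g' : PBond (F.P K) (k + 1) → SU N),
          {g : SU N | ∀ i : Idx (F.P K), dist1 (fibreFamily (extend centralBond g' U) c
              (pre (extend centralBond g' U) c * g * post (extend centralBond g' U) c) i) ≤ α} =
            {g : SU N | ∀ i : Idx (F.P K), dist1 (fibreFamily U c (pre U c * g * post U c) i) ≤ α}) ∧
      (∀ c, MeasurableSet {p : GaugeField (F.P K) k (SU N) × SU N | p.2 ∈ T c p.1}) ∧
      (∀ c, Measurable fun p : GaugeField (F.P K) k (SU N) × SU N => ϑ c p.1 p.2) ∧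
      (∀ c, Measurable fun p : GaugeField (F.P K) k (SU N) × SU N => jd c p.1 p.2) ∧
      (∀ c U, ∀ v ∈ T c U, (avOfRecord F N K k).avg (update U (centralBond c) (ϑ c U v)) c = v) ∧
      (∀ c U, (HaarData.haar : Measure (SU N)).restrict {g : SU N | ∀ i : Idx (F.P K), dist1 (fibreFamily U c (pre U c * g * post U c) i) ≤ α} =
        (((HaarData.haar : Measure (SU N)).restrict (T c U)).withDensity fun v => (jd c U v : ℝ≥0∞)).map (ϑ c U)) ∧
      (∀ c U, T c U = (fun g => (avOfRecord F N K k).avg (update U (centralBond c) g) c) ''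
          {g : SU N | ∀ i : Idx (F.P K), dist1 (fibreFamily U c (pre U c * g * post U c) i) ≤ α}) ∧
      (∀ c U g, (∀ i : Idx (F.P K), dist1 (fibreFamily U c (pre U c * g * post U c) i) ≤ α) →
          ϑ c U ((avOfRecord F N K k).avg (update U (centralBond c) g) c) = g) ∧
      (∀ c U, ∀ v ∈ T c U, ∀ i : Idx (F.P K), dist1 (fibreFamily U c (pre U c * ϑ c U v * post U c) i) ≤ α) := by
  have hkr : k + 1 ≤ (F.P K).m + (F.P K).K := succ_le_m_add_K hk
  have hmeas : ∀ c : PBond (F.P K) (k + 1), MeasurableSet {p : GaugeField (F.P K) k (SU N) × SU N |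
      p.2 ∈ {g : SU N | ∀ i : Idx (F.P K), dist1 (fibreFamily p.1 c (pre p.1 c * g * post p.1 c) i) ≤ α}} :=
    fun c => measurableSet_centralWindow c α
  have hinj : ∀ (c : PBond (F.P K) (k + 1)) (U : GaugeField (F.P K) k (SU N)),
      InjOn (fun g => (avOfRecord F N K k).avg (update U (centralBond c) g) c)
        {g : SU N | ∀ i : Idx (F.P K), dist1 (fibreFamily U c (pre U c * g * post U c) i) ≤ α} :=
    fun c U => avgFun_update_centralBond_injOn_centralWindow hkr U c hα0 hα hαδ (hgap c)
  obtain ⟨T, ϑ, jd, h1, h2, h3, h4, h5, h6, h7, h8⟩ := exists_perBondCharts_of_injectivityWindows_ac (F := F) (N := N) hk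
    (fun c U => {g : SU N | ∀ i : Idx (F.P K), dist1 (fibreFamily U c (pre U c * g * post U c) i) ≤ α}) hmeas hinj
  exact ⟨T, ϑ, jd, hmeas, fun c U g' => centralWindow_extend hkr c α U g', h1, h2, h3, h4, h5, h6, fun c U g hg => h7 c U g hg,
    fun c U v hv => h8 c U v hv⟩

/-- **★★★ (B4)'s CHART HALF AT `fieldMeasure` ON THE CENTRAL α-WINDOW, NO PER-BOND HYPOTHESIS.**  At step `k < K`, for `0 ≤ α ≤ 1∕24`, `α < δ_N`, `offCard c ∕ |Idx| + 150α < 1`: THERE ARE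
`(T, ϑ, jd)` — jointly measurable — such that with `Ψ (V,U) = extend β (c ↦ ϑ_c(U, V c)) U`, `J (V,U) = 𝟙[∀ c, V c ∈ T_c(U)]·∏_c jd_c(U, V c)`: (i) dag-n11-d's `hpush` holds at
`(dV, Kernel.const _ dU)` with charted set `S_α = {U | ∀ c i, dist1 (loopHol U c i) ≤ α}` (every (0.4) loop variable α-small); (ii) `hfib`; (iii) for every `dU`-integrable measurable `ρ` with
the SUPPORT CLAUSE «`ρ U ≠ 0 ⇒ ∀ c i, dist1 (loopHol U c i) ≤ α`»: `transportOfRecord F N K k ρ =ᵐ[dV] V ↦ ∫ dU J(V,U)·ρ(Ψ(V,U))`.  Print's `∫dU δ(ŪV⁻¹)ρ(U)` ([I] (0.4), [III] (3.1)) as an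
honest `dU`-integral on the small-loop region, the δ-functions removed by inverting `g ↦ Ū′(c)` on the central α-window.
[cite: Balaban1988Convergent, (3.1) p.264, p.267 L18–24; Balaban1987RG1, (0.4) p.253, (2.9)–(2.10) pp.266–267] -/
theorem exists_chart_transportOfRecord_ae_eq_centralWindow (hk : k < K) {α : ℝ} (hα0 : 0 ≤ α) (hα : α ≤ 1 / 24)
    (hαδ : α < deltaSU (Fin N)) (hgap : ∀ c : PBond (F.P K) (k + 1), (offCard c : ℝ) / (Fintype.card (Idx (F.P K)) : ℝ) + 150 * α < 1) :
    ∃ (T : PBond (F.P K) (k + 1) → GaugeField (F.P K) k (SU N) → Set (SU N))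
      (ϑ : PBond (F.P K) (k + 1) → GaugeField (F.P K) k (SU N) → SU N → SU N)
      (jd : PBond (F.P K) (k + 1) → GaugeField (F.P K) k (SU N) → SU N → ℝ≥0),
      (∀ c, MeasurableSet {p : GaugeField (F.P K) k (SU N) × SU N | p.2 ∈ T c p.1}) ∧
      (∀ c, Measurable fun p : GaugeField (F.P K) k (SU N) × SU N => ϑ c p.1 p.2) ∧
      (∀ c, Measurable fun p : GaugeField (F.P K) k (SU N) × SU N => jd c p.1 p.2) ∧
      (((fieldMeasure (F.P K) (k + 1) (SU N)) ⊗ₘ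
          (Kernel.const (GaugeField (F.P K) (k + 1) (SU N)) (fieldMeasure (F.P K) k (SU N)))).withDensity fun z =>
            (({p : GaugeField (F.P K) (k + 1) (SU N) × GaugeField (F.P K) k (SU N) | ∀ c, p.1 c ∈ T c p.2}.indicator
              (fun p => ∏ c, jd c p.2 (p.1 c)) z : ℝ≥0) : ℝ≥0∞)).map
          (fun z : GaugeField (F.P K) (k + 1) (SU N) × GaugeField (F.P K) k (SU N) =>
            (extend centralBond (fun c => ϑ c z.2 (z.1 c)) z.2 : GaugeField (F.P K) k (SU N))) =
        (fieldMeasure (F.P K) k (SU N)).restrict {U | ∀ (c : PBond (F.P K) (k + 1)) (i : Idx (F.P K)), dist1 (loopHol U c i) ≤ α} ∧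
      (∀ᵐ z ∂(((fieldMeasure (F.P K) (k + 1) (SU N)) ⊗ₘ
          (Kernel.const (GaugeField (F.P K) (k + 1) (SU N)) (fieldMeasure (F.P K) k (SU N)))).withDensity fun z =>
            (({p : GaugeField (F.P K) (k + 1) (SU N) × GaugeField (F.P K) k (SU N) | ∀ c, p.1 c ∈ T c p.2}.indicator
              (fun p => ∏ c, jd c p.2 (p.1 c)) z : ℝ≥0) : ℝ≥0∞)),
        (avOfRecord F N K k).avg (extend centralBond (fun c => ϑ c z.2 (z.1 c)) z.2 : GaugeField (F.P K) k (SU N)) = z.1) ∧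
      (∀ {ρ : Density (F.P K) k (SU N)}, Measurable ρ → Integrable ρ (fieldMeasure (F.P K) k (SU N)) →
        (∀ U, ρ U ≠ 0 → ∀ (c : PBond (F.P K) (k + 1)) (i : Idx (F.P K)), dist1 (loopHol U c i) ≤ α) →
        transportOfRecord F N K k ρ =ᵐ[fieldMeasure (F.P K) (k + 1) (SU N)] fun V => ∫ U,
          (({p : GaugeField (F.P K) (k + 1) (SU N) × GaugeField (F.P K) k (SU N) | ∀ c, p.1 c ∈ T c p.2}.indicator
              (fun p => ∏ c, jd c p.2 (p.1 c)) (V, U) : ℝ≥0) : ℝ) *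
            ρ (extend centralBond (fun c => ϑ c U (V c)) U : GaugeField (F.P K) k (SU N)) ∂(fieldMeasure (F.P K) k (SU N))) := by
  have hkr : k + 1 ≤ (F.P K).m + (F.P K).K := succ_le_m_add_K hk
  -- the charted set of the central windows is the small-loop region
  have hS : {U : GaugeField (F.P K) k (SU N) | ∀ c, U (centralBond c) ∈
      {g : SU N | ∀ i : Idx (F.P K), dist1 (fibreFamily U c (pre U c * g * post U c) i) ≤ α}} =
      {U | ∀ (c : PBond (F.P K) (k + 1)) (i : Idx (F.P K)), dist1 (loopHol U c i) ≤ α} := by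
    ext U
    exact forall_congr' fun c => self_mem_centralWindow_iff hkr U c α
  obtain ⟨T, ϑ, jd, hTm, hθm, hjm, hpush, hfib, htr⟩ := exists_chart_transportOfRecord_ae_eq_of_injectivityWindows (F := F) (N := N) hk
    (fun c U => {g : SU N | ∀ i : Idx (F.P K), dist1 (fibreFamily U c (pre U c * g * post U c) i) ≤ α})
    (fun c => measurableSet_centralWindow c α) (fun c U g' => centralWindow_extend hkr c α U g')
    (fun c U => avgFun_update_centralBond_injOn_centralWindow hkr U c hα0 hα hαδ (hgap c))
  refine ⟨T, ϑ, jd, hTm, hθm, hjm, ?_, hfib, fun hρm hρ hS' => htr hρm hρ fun U hU c => ?_⟩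
  · rw [← hS]; exact hpush
  · exact (self_mem_centralWindow_iff hkr U c α).2 (hS' U hU c)

/-! ## §2  The support clause in plaquette currency -/

/-- **SMALL PLAQUETTES ON THE THREE BLOCKS ⇒ SMALL LOOPS** (pub-balaban's local Stokes bound, by name): if every fine plaquette based in `B(c₋ − e_μ) ∪ B(c₋) ∪ B(c₊)` is within `δ ≥ 0` of `1`
and `((d+2)L)²∕4 · δ ≤ α`, then every (0.4) loop variable at `c` is `α`-small. [cite: Balaban1987RG1, (0.4) p.253 and (2.9) p.266] -/
theorem loops_small_of_plaqSmallOn_blocks (hkr : k + 1 ≤ (F.P K).m + (F.P K).K) {δ α : ℝ} (hδ : 0 ≤ δ)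
    (hδα : ((((F.P K).d + 2) * (F.P K).L : ℕ) : ℝ) ^ 2 / 4 * δ ≤ α) (U : GaugeField (F.P K) k (SU N)) (c : PBond (F.P K) (k + 1))
    (hU : ∀ q : Plaq (F.P K) k, (blockOf q.src = c.src.unshift c.dir ∨ blockOf q.src = c.src ∨ blockOf q.src = c.tgt) →
      dist1 (GaugeField.plaqHol U q) < δ) (i : Idx (F.P K)) :
    dist1 (loopHol U c i) ≤ α :=
  (dist1_loopHol_le_local hδ hkr c hU i).trans hδα

/-- **★ THE CHART OF RECORD ON THE CENTRAL WINDOW WITH THE SUPPORT CLAUSE IN PLAQUETTE CURRENCY**: as `exists_chart_transportOfRecord_ae_eq_centralWindow`, the transport identity holding for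
every `dU`-integrable measurable `ρ` such that, wherever `ρ(U) ≠ 0`, every fine plaquette based in the three blocks around EVERY coarse bond is within `δ` of `1`, `((d+2)L)²∕4 · δ ≤ α` — the
shape in which the small-field characteristic functions of (2.17) ∕ (3.3) constrain a density's support. [cite: Balaban1988Convergent, (2.17) p.257, (3.1) p.264, (3.3) p.265, p.267 L18–24; Balaban1987RG1, (0.4) p.253] -/
theorem exists_chart_transportOfRecord_ae_eq_of_plaqSmallSupport (hk : k < K) {α : ℝ} (hα0 : 0 ≤ α) (hα : α ≤ 1 / 24)
    (hαδ : α < deltaSU (Fin N)) (hgap : ∀ c : PBond (F.P K) (k + 1), (offCard c : ℝ) / (Fintype.card (Idx (F.P K)) : ℝ) + 150 * α < 1)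
    {δ : ℝ} (hδ : 0 ≤ δ) (hδα : ((((F.P K).d + 2) * (F.P K).L : ℕ) : ℝ) ^ 2 / 4 * δ ≤ α) :
    ∃ (T : PBond (F.P K) (k + 1) → GaugeField (F.P K) k (SU N) → Set (SU N))
      (ϑ : PBond (F.P K) (k + 1) → GaugeField (F.P K) k (SU N) → SU N → SU N)
      (jd : PBond (F.P K) (k + 1) → GaugeField (F.P K) k (SU N) → SU N → ℝ≥0),
      (∀ c, MeasurableSet {p : GaugeField (F.P K) k (SU N) × SU N | p.2 ∈ T c p.1}) ∧
      (∀ c, Measurable fun p : GaugeField (F.P K) k (SU N) × SU N => ϑ c p.1 p.2) ∧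
      (∀ c, Measurable fun p : GaugeField (F.P K) k (SU N) × SU N => jd c p.1 p.2) ∧
      (∀ {ρ : Density (F.P K) k (SU N)}, Measurable ρ → Integrable ρ (fieldMeasure (F.P K) k (SU N)) →
        (∀ U, ρ U ≠ 0 → ∀ (c : PBond (F.P K) (k + 1)) (q : Plaq (F.P K) k),
          (blockOf q.src = c.src.unshift c.dir ∨ blockOf q.src = c.src ∨ blockOf q.src = c.tgt) → dist1 (GaugeField.plaqHol U q) < δ) →
        transportOfRecord F N K k ρ =ᵐ[fieldMeasure (F.P K) (k + 1) (SU N)] fun V => ∫ U,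
          (({p : GaugeField (F.P K) (k + 1) (SU N) × GaugeField (F.P K) k (SU N) | ∀ c, p.1 c ∈ T c p.2}.indicator
              (fun p => ∏ c, jd c p.2 (p.1 c)) (V, U) : ℝ≥0) : ℝ) *
            ρ (extend centralBond (fun c => ϑ c U (V c)) U : GaugeField (F.P K) k (SU N)) ∂(fieldMeasure (F.P K) k (SU N))) := by
  have hkr : k + 1 ≤ (F.P K).m + (F.P K).K := succ_le_m_add_K hk
  obtain ⟨T, ϑ, jd, hTm, hθm, hjm, -, -, htr⟩ := exists_chart_transportOfRecord_ae_eq_centralWindow (F := F) (N := N) hk hα0 hα hαδ hgap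
  exact ⟨T, ϑ, jd, hTm, hθm, hjm, fun hρm hρ hS => htr hρm hρ fun U hU c i =>
    loops_small_of_plaqSmallOn_blocks hkr hδ hδα U c (hS U hU c) i⟩

/-! ## §3  The INNER chart of the separated transport on the central α-window, no per-bond hypothesis -/

section Inner

open B10Eq42TorusConstraint (bondsIn)
open B10Eq38TorusDomains (toFine)

/-- **★★★ THE SEPARATED TRANSPORT OF RECORD WITH THE INNER STEP CHARTED ON THE CENTRAL α-WINDOW, EVERY DENSITY, NO PER-BOND HYPOTHESIS** (file 3c's
`transportOfRecord_comp_glue_ae_eq_kernelRTOfRecord_privateInnerChart` at the per-bond bundle of `exists_perBondCharts_centralWindow_ac`): at step `k < K`, for `0 ≤ α ≤ 1∕24`, `α < δ_N`,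
`offCard c ∕ |Idx| + 150α < 1`, a fine region `Y` saturated at level `k+1` with bond sets `sV ↔ bondsIn k Y`, `sV′ ↔ bondsIn (k+1) Y`: THERE ARE jointly measurable `(T, ϑ, jd)` such that for EVERY
`dU`-integrable measurable density `ρ` with the support clause «`ρ U ≠ 0 ⇒` at every coarse bond `c ∉ sV′`, every (0.4) loop variable of `U` at `c` is `≤ α`»:
`(transportOfRecord F N K k ρ) ∘ e_{sV′}⁻¹ =ᵐ (V_out, v₂) ↦ kernelRTOfRecord F N K k sV sV′ [y ↦ ∫ dr 𝟙·∏ jd · ρ(e_sV⁻¹(y, extend β′ (ϑ_c(e_sV⁻¹(y,r), v₂ c))_c r))] V_out` — outside by 11a's un-charted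
restricted transport, inside resampled on the central windows.  The `hin₀` feeder of dag-n11-d's (O3′) ∕ BranchSum chain with NOTHING displayed but the support clause.
[cite: Balaban1988Convergent, (2.21) p.258, (3.1) p.264, p.267 L18–24; Balaban1987RG1, (0.4) p.253, (2.9)–(2.10) pp.266–267; Kechris1995, Thm 15.1] -/
theorem exists_innerChart_transportOfRecord_ae_eq_centralWindow (hk : k < K) {α : ℝ} (hα0 : 0 ≤ α) (hα : α ≤ 1 / 24) (hαδ : α < deltaSU (Fin N))
    (hgap : ∀ c : PBond (F.P K) (k + 1), (offCard c : ℝ) / (Fintype.card (Idx (F.P K)) : ℝ) + 150 * α < 1)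
    {Y : Set (Site (F.P K) 0)} (hY : ∀ s : Site (F.P K) k, toFine k s ∈ Y ↔ toFine (k + 1) (blockOf s) ∈ Y)
    {sV : Finset (PBond (F.P K) k)} (hsV : ∀ b : PBond (F.P K) k, b ∈ sV ↔ b ∈ bondsIn k Y)
    {sV' : Finset (PBond (F.P K) (k + 1))} (hsV' : ∀ c : PBond (F.P K) (k + 1), c ∈ sV' ↔ c ∈ bondsIn (k + 1) Y)
    (hβ' : ∀ c : PBond (F.P K) (k + 1), c ∉ sV' → centralBond c ∉ sV) :
    ∃ (T : PBond (F.P K) (k + 1) → GaugeField (F.P K) k (SU N) → Set (SU N))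
      (ϑ : PBond (F.P K) (k + 1) → GaugeField (F.P K) k (SU N) → SU N → SU N)
      (jd : PBond (F.P K) (k + 1) → GaugeField (F.P K) k (SU N) → SU N → ℝ≥0),
      (∀ c, MeasurableSet {p : GaugeField (F.P K) k (SU N) × SU N | p.2 ∈ T c p.1}) ∧
      (∀ c, Measurable fun p : GaugeField (F.P K) k (SU N) × SU N => ϑ c p.1 p.2) ∧
      (∀ c, Measurable fun p : GaugeField (F.P K) k (SU N) × SU N => jd c p.1 p.2) ∧
      (∀ {ρ : Density (F.P K) k (SU N)}, Measurable ρ → Integrable ρ (fieldMeasure (F.P K) k (SU N)) →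
        (∀ U, ρ U ≠ 0 → ∀ c, c ∉ sV' → ∀ i : Idx (F.P K), dist1 (loopHol U c i) ≤ α) →
        (transportOfRecord F N K k ρ) ∘ ⇑(MeasurableEquiv.piEquivPiSubtypeProd (fun _ : PBond (F.P K) (k + 1) => SU N) (· ∈ sV')).symm
          =ᵐ[(Measure.pi fun _ : ↥sV' => (HaarData.haar : Measure (SU N))).prod
              (Measure.pi fun _ : {c : PBond (F.P K) (k + 1) // c ∉ sV'} => (HaarData.haar : Measure (SU N)))]
            fun v => kernelRTOfRecord F N K k sV sV'
              (fun y => ∫ r,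
                (({z : ((↥sV → SU N) × ({c : PBond (F.P K) (k + 1) // c ∉ sV'} → SU N)) × ({b : PBond (F.P K) k // b ∉ sV} → SU N) |
                    ∀ c : {c : PBond (F.P K) (k + 1) // c ∉ sV'},
                      z.1.2 c ∈ T c ((MeasurableEquiv.piEquivPiSubtypeProd (fun _ : PBond (F.P K) k => SU N) (· ∈ sV)).symm (z.1.1, z.2))}.indicator
                  (fun z => ∏ c : {c : PBond (F.P K) (k + 1) // c ∉ sV'},
                    jd c ((MeasurableEquiv.piEquivPiSubtypeProd (fun _ : PBond (F.P K) k => SU N) (· ∈ sV)).symm (z.1.1, z.2)) (z.1.2 c)) ((y, v.2), r) : ℝ≥0) : ℝ) *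
                ρ ((MeasurableEquiv.piEquivPiSubtypeProd (fun _ : PBond (F.P K) k => SU N) (· ∈ sV)).symm
                    (y, extend (fun c : {c : PBond (F.P K) (k + 1) // c ∉ sV'} =>
                        (⟨centralBond (c : PBond (F.P K) (k + 1)), hβ' c c.2⟩ : {b : PBond (F.P K) k // b ∉ sV}))
                      (fun c : {c : PBond (F.P K) (k + 1) // c ∉ sV'} =>
                        ϑ c ((MeasurableEquiv.piEquivPiSubtypeProd (fun _ : PBond (F.P K) k => SU N) (· ∈ sV)).symm (y, r)) (v.2 c)) r))
                ∂(Measure.pi fun _ : {b : PBond (F.P K) k // b ∉ sV} => (HaarData.haar : Measure (SU N))))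
              v.1) := by
  have hkr : k + 1 ≤ (F.P K).m + (F.P K).K := succ_le_m_add_K hk
  obtain ⟨T, ϑ, jd, hΩm, hΩbl, hTm, hθm, hjm, hright, hlaw, -, -, -⟩ := exists_perBondCharts_centralWindow_ac (F := F) (N := N) hk hα0 hα hαδ hgap
  refine ⟨T, ϑ, jd, hTm, hθm, hjm, fun hρm hρ hS => ?_⟩
  exact transportOfRecord_comp_glue_ae_eq_kernelRTOfRecord_privateInnerChart
    (fun c U => {g : SU N | ∀ i : Idx (F.P K), dist1 (fibreFamily U c (pre U c * g * post U c) i) ≤ α}) T ϑ jd hk hY hsV hsV'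
    hΩm hTm hθm hjm hΩbl hright hlaw hρm hρ
    (fun U hU c hc => (self_mem_centralWindow_iff hkr U c α).2 (hS U hU c hc)) hβ'

end Inner

end Summit.QuantumFields.YangMills.Theorems.BalabanUVNodesN11PrivateChartOfCentralWindow

end
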